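import Literature.Probability.LatticeModels.FKIsingBarToRectangle
import Literature.Barriers.CriticalPhenomena.RandomClusterFirstOrderProofs
import Summits.CriticalPhenomena.Ising3DConformalLimit.Theorems.ParityRobustMerging.Negative.HWorld
import Summits.CriticalPhenomena.Ising3DConformalLimit.Theorems.ArmDressingArmDressingGlueDefs
import HarnessLib

/-!
# Route `ArmDressing`, crux `ArmDressingGlue` (stmt-CriticalPhenomena-15700):
# stub `stub_arm1Pos`

Clause (b) of the support `InfiniteVolumeEdwardsSokal` of the route, in the vocabulary of
`ArmDressingArmDressingGlueDefs`, from clause (a): under `WiredBoxLimit` (the wired critical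
FK-Ising box probabilities `PrL m K R L` converge as `L → ∞`), the one-arm probability
`arm1 δ 1 = φ[0 ↔ ((B(0,1))ᶜ)^δ]` (origin joined by an open path to a lattice point at Euclidean
mesh-distance `≥ 1`, i.e. lattice distance `≥ 1/δ`) is positive for every mesh `δ ∈ (0, 1]`.

Proof.  The family `K = ![{0}, ((B(0,1))ᶜ)^δ]` has a finite first member, so the pairwise
intersection hypothesis of `WiredBoxLimit` is vacuous and `arm1 δ 1 = lim_L PrL 2 K {R | R 0 1} L`
is a genuine limit (`Filter.Tendsto.limUnder_eq`).  Positivity is then a lower bound UNIFORM in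
the box: with `N = ⌈1/δ⌉₊`, the lattice point `N e₀` lies in `((B(0,1))ᶜ)^δ` (`‖δ N e₀‖ = δ N ≥ 1`)
and in every box `Λ_L`, `L ≥ N` (`axisVertex`); the event of `PrL` contains
`{0 ↔ N e₀ by open edges of Λ_L}`, whose wired-box probability is at least `(p/(p + 2(1-p)))^N` by
FINITE ENERGY along the straight lattice path of length `N` (`rcMeasure_real_reachable_ge_pow`,
Grimmett 2006 Thm. (3.1)(a) with FKG, Thm. (3.8)), where `p = 1 - e^{-2β_c(3)} > 0` because
`β_c(3) > 0` (Peierls; `criticalBeta_pos_holds`, through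
`ParityRobustMergingNegative.fkIsingParam_criticalBeta_pos`).  Hence
`arm1 δ 1 ≥ (p/(p + 2(1-p)))^N > 0` (`ge_of_tendsto`).

References: G. Grimmett, *The Random-Cluster Model* (2006), Thm. (3.1)(a), Thm. (3.8), Thm. (4.19);
F. Camia, Y. Feng, arXiv:2411.01467 (2025), remark after Thm 1.
-/

noncomputable section

namespace Summit.CriticalPhenomena.Ising3DConformalLimit.Cruxes.ArmDressingGlue.Arm1PosProof

open Summit.CriticalPhenomena.Ising3DConformalLimit.Cruxes.ArmDressingGlue.Vocab
open Summit.CriticalPhenomena.Ising3DConformalLimit.ParityRobustMergingNegative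
  (fkIsingParam_criticalBeta_pos)
open scoped Topology
open Filter MeasureTheory Literature.Probability.LatticeModels Literature.Probability.Percolation
open Literature.Barriers.CriticalPhenomena

/-- The straight lattice segment from the origin to the axis vertex `k e₀` (`axisVertex 0 L k`) is a
walk of length `k` of the box graph `Λ_L`, `k ≤ L`. [folklore] -/
theorem exists_walk_axisVertex (L : ℕ) :
    ∀ (k : ℕ) (hk : k ≤ L), ∃ w : (boxGraph 3 L).Walk (boxOrigin 3 L) (axisVertex 0 L k hk),
      w.length = k := by
  intro k
  induction k with
  | zero =>
    intro hk
    have h0 : axisVertex 0 L 0 hk = boxOrigin 3 L := Subtype.ext (by simp [axisVertex, boxOrigin])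
    rw [h0]
    exact ⟨SimpleGraph.Walk.nil, rfl⟩
  | succ k ih =>
    intro hk
    obtain ⟨w, hw⟩ := ih (Nat.le_of_succ_le hk)
    have hadj : (boxGraph 3 L).Adj (axisVertex 0 L k (Nat.le_of_succ_le hk)) (axisVertex 0 L (k + 1) hk) := by
      rw [boxGraph, SimpleGraph.comap_adj, zdGraph_adj_iff]
      refine ⟨0, Or.inl ?_⟩
      simp only [axisVertex]
      push_cast
      rw [Pi.single_add]
    exact ⟨w.concat hadj, by rw [SimpleGraph.Walk.length_concat, hw]⟩

/-- The finite-energy ratio `p/(p + 2(1-p))` of critical FK-Ising on `ℤ³` is positive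
(`p = 1 - e^{-2β_c(3)} > 0` by `β_c(3) > 0`). [cite: Grimmett2006, Thm. (3.1)(a)] -/
theorem energyRatio_pos :
    0 < fkIsingParam (criticalBeta 3) /
      (fkIsingParam (criticalBeta 3) + 2 * (1 - fkIsingParam (criticalBeta 3))) := by
  have hp : fkIsingParam (criticalBeta 3) ∈ Set.Icc (0:ℝ) 1 := fkIsingParam_criticalBeta_mem_Icc
  have hp0 : 0 < fkIsingParam (criticalBeta 3) := fkIsingParam_criticalBeta_pos
  exact div_pos hp0 (by nlinarith [hp.2])

/-- The lattice point `⌈1/δ⌉₊ e₀` belongs to the discretised exterior `((B(0,1))ᶜ)^δ` of the unit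
ball: `‖δ ⌈1/δ⌉₊ e₀‖ ≥ δ ⌈1/δ⌉₊ ≥ 1`. [folklore] -/
theorem single_ceil_mem_disc {δ : ℝ} (hδ : 0 < δ) :
    (Pi.single 0 (⌈δ⁻¹⌉₊ : ℤ) : Site 3) ∈
      disc δ (Metric.ball (0 : EuclideanSpace ℝ (Fin 3)) 1)ᶜ := by
  rw [mem_disc, Set.mem_compl_iff, Metric.mem_ball, dist_zero_right, not_lt]
  have h0 : ‖(mesh δ (Pi.single 0 (⌈δ⁻¹⌉₊ : ℤ))) 0‖ = δ * ⌈δ⁻¹⌉₊ := by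
    simp only [mesh_apply, Pi.single_eq_same, Int.cast_natCast, Real.norm_eq_abs]
    exact abs_of_nonneg (by positivity)
  calc (1 : ℝ) = δ * δ⁻¹ := (mul_inv_cancel₀ hδ.ne').symm
    _ ≤ δ * ⌈δ⁻¹⌉₊ := mul_le_mul_of_nonneg_left (Nat.le_ceil _) hδ.le
    _ = ‖(mesh δ (Pi.single 0 (⌈δ⁻¹⌉₊ : ℤ))) 0‖ := h0.symm
    _ ≤ ‖mesh δ (Pi.single 0 (⌈δ⁻¹⌉₊ : ℤ))‖ := PiLp.norm_apply_le _ _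

/-- **Uniform finite-energy lower bound for the one-arm box probabilities**: for `δ > 0` and every
box `Λ_L` with `L ≥ N := ⌈1/δ⌉₊`,
`PrL 2 ![{0}, ((B(0,1))ᶜ)^δ] {R | R 0 1} L ≥ (p/(p + 2(1-p)))^N`, `p = 1 - e^{-2β_c(3)}`: the event
contains `{0 ↔ N e₀}` and the straight path has `N` edges (Grimmett 2006, Thm. (3.1)(a) and
Thm. (3.8)). [cite: Grimmett2006, Thm. (3.1)(a) and Thm. (3.8)] -/
theorem energyRatio_pow_le_PrL {δ : ℝ} (hδ : 0 < δ) {L : ℕ} (hL : ⌈δ⁻¹⌉₊ ≤ L) :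
    (fkIsingParam (criticalBeta 3) /
        (fkIsingParam (criticalBeta 3) + 2 * (1 - fkIsingParam (criticalBeta 3)))) ^ ⌈δ⁻¹⌉₊ ≤
      PrL 2 ![{(0 : Site 3)}, disc δ (Metric.ball (0 : EuclideanSpace ℝ (Fin 3)) 1)ᶜ]
        {R | R 0 1} L := by
  have hp : fkIsingParam (criticalBeta 3) ∈ Set.Icc (0:ℝ) 1 := fkIsingParam_criticalBeta_mem_Icc
  obtain ⟨w, hw⟩ := exists_walk_axisVertex L _ hL
  -- finite energy along the straight path `0 → N e₀`
  have h1 : (fkIsingParam (criticalBeta 3) /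
        (fkIsingParam (criticalBeta 3) + 2 * (1 - fkIsingParam (criticalBeta 3)))) ^ ⌈δ⁻¹⌉₊ ≤
      (μ L).real {ω | (openGraph ω).Reachable (boxOrigin 3 L) (axisVertex 0 L _ hL)} := by
    have h := rcMeasure_real_reachable_ge_pow (boxGraph 3 L) hp (by norm_num : (1:ℝ) ≤ 2)
      (boxBoundary 3 L) w
    rw [hw] at h
    exact h
  -- the event of `PrL` contains `{0 ↔ N e₀}`
  have hsub : {ω : BondConfig (BoxV 3 L) | (openGraph ω).Reachable (boxOrigin 3 L) (axisVertex 0 L _ hL)} ⊆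
      {ω | (fun i j => ∃ x y : BoxV 3 L,
        x.1 ∈ (![{(0 : Site 3)}, disc δ (Metric.ball (0 : EuclideanSpace ℝ (Fin 3)) 1)ᶜ] :
          Fin 2 → Set (Site 3)) i ∧
        y.1 ∈ (![{(0 : Site 3)}, disc δ (Metric.ball (0 : EuclideanSpace ℝ (Fin 3)) 1)ᶜ] :
          Fin 2 → Set (Site 3)) j ∧
        (openGraph ω).Reachable x y) ∈ {R : Fin 2 → Fin 2 → Prop | R 0 1}} := by
    intro ω hω
    refine ⟨boxOrigin 3 L, axisVertex 0 L _ hL, by simp [boxOrigin], ?_, hω⟩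
    simp only [Matrix.cons_val_one, axisVertex]
    exact single_ceil_mem_disc hδ
  exact h1.trans (measureReal_mono hsub (measure_ne_top _ _))

/-- The pairwise-intersection hypothesis of `WiredBoxLimit` is vacuous for a two-member family whose
first member is a singleton. [folklore] -/
theorem interHyp_of_singleton (a : Site 3) (B : Set (Site 3)) :
    ∀ i j : Fin 2, i ≠ j → ((![{a}, B] : Fin 2 → Set (Site 3)) i).Infinite →
      ((![{a}, B] : Fin 2 → Set (Site 3)) j).Infinite →
        ((![{a}, B] : Fin 2 → Set (Site 3)) i ∩ (![{a}, B] : Fin 2 → Set (Site 3)) j).Nonempty := by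
  intro i j hij hi hj
  exfalso
  fin_cases i <;> fin_cases j
  · exact hij rfl
  · simp at hi
  · simp at hj
  · exact hij rfl

/-- **Clause (b) of the support ES from clause (a)** (registered stub `stub_arm1Pos` of the skeleton
of `ArmDressingGlue`): under `WiredBoxLimit`, `arm1 δ 1 > 0` for every `δ ∈ (0, 1]` — the one-arm
probability is the limit of the wired-box probabilities, which are bounded below uniformly in the
box by finite energy along a lattice path of `⌈1/δ⌉₊` edges (Grimmett 2006, Thm. (3.1)(a),
Thm. (3.8), Thm. (4.19)). [cite: Grimmett2006, Thm. (3.1)(a) and Thm. (3.8)] -/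
theorem stub_arm1Pos : WiredBoxLimit → Arm1Pos := by
  intro hW δ hδ
  have hδ0 : 0 < δ := hδ.1
  -- (1) the limit defining `arm1 δ 1` exists
  obtain ⟨l, hl⟩ := hW 2 ![{(0 : Site 3)}, disc δ (Metric.ball (0 : EuclideanSpace ℝ (Fin 3)) 1)ᶜ]
    {R | R 0 1} (interHyp_of_singleton 0 _)
  have harm : arm1 δ 1 = l := hl.limUnder_eq
  rw [harm]
  -- (2) uniform lower bound along the tail `L ≥ ⌈1/δ⌉₊`
  exact lt_of_lt_of_le (pow_pos energyRatio_pos ⌈δ⁻¹⌉₊)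
    (ge_of_tendsto hl (eventually_atTop.2 ⟨⌈δ⁻¹⌉₊, fun L hL => energyRatio_pow_le_PrL hδ0 hL⟩))

end Summit.CriticalPhenomena.Ising3DConformalLimit.Cruxes.ArmDressingGlue.Arm1PosProof

end
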